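import Literature.AlgebraicGeometry.ShimuraVarieties.UnitaryCurveSpecialPairCMStructure
import Literature.AlgebraicGeometry.ShimuraVarieties.UnitaryCurveAuxiliaryComplexStructure
import Literature.AlgebraicGeometry.ShimuraVarieties.UnitaryAuxiliarySpecialPairSpan
import Literature.AlgebraicGeometry.ShimuraVarieties.UnitaryGroupDiagonalTwistExists
import HarnessLib

/-!
# E2's complex structure `J_Φ(v)` and the frame CM structure form a SPECIAL PAIR — any rank `n`
# ([Deligne 1971] 4.18 / 5.11, [Deligne 1979] Prop. 2.3.10, [Milne 2005] Def. 12.5 / Ex. 12.4 (b); rank-`n`, `W₀`-free copy of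
# `UnitaryAuxiliaryComplexStructureFrame` + `UnitaryAuxiliarySpecialPairSpan` + `isSpecial_of_frame_spec_of_line`)

Topic `AlgebraicGeometry/ShimuraVarieties`; namespace `Literature.AlgebraicGeometry.ShimuraVarieties.UnitaryCurve.AuxV`.
THEOREMS ONLY (no definition, no named fact, no instance, no `sorry`; net Literature debt 0).  Cell `hodgecm-mathlib` (D-0151),
FLOOR 0, P6 «MOD programme», door (E) of `stub_RGD`, organ E3R: the discharge of the special-pair clause `hJsp` of ★
`UnitaryCurve.AuxV.exists_sliceField_siegelRecipDatum` (★ `UnitaryCurveSpecialPairReciprocity`) for E2's ★ `auxComplexStructureV`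
(★ `UnitaryCurveAuxiliaryComplexStructure`).  `--supports stmt-HodgeConjecture-24832`, count-neutral; HC_CM is proved only modulo the printed
citations until rung 0 closes.

THE STATEMENT ([Deligne1971TravauxShimura] 4.18 «`h` se factorise par le tore de `L`», 5.11; [Milne2005ShimuraVarieties] Ex. 12.4 (b)).  For the
`W₀`-free symplectic module `(V_M, ψ_V)` with frame `β` (★ `SymplecticFrameV`), an `H^j`-ORTHOGONAL `M`-frame `B ∈ GL_n(M)` whose column `b_{p₀}`
spans, at every `ρ ∈ Φ` over `τ`, the negative line `ℂv` (`v = c·ρ(b_{p₀})`), and the frame CM structure `c_B` (★ FILE A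
`exists_cmStructureV_of_orthogonal`, pinned on the frame vectors), the pair `(c_B, J_Φ(v))` is SPECIAL (★ `CMStructure.IsSpecial`) with CM types
`Φ′_p = Φ` (`p ≠ p₀`) and `Φ′_{p₀} = Φ^τ̄ = (Φ ∖ {ρ | ρ∘j = τ}) ∪ {ρ | ρ∘j = τ̄}`: `J = β·res(iPhi·s_v)·β⁻¹` is the image of the element
`u = (iPhi, …, iPhi·ε, …, iPhi) ∈ F ⊗ ℝ = (ℝ ⊗_ℚ M)^{Fin n}` (`ε` the element with `Φ`-components `−1` over `τ`, `+1` elsewhere) under the CM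
action — `s_v` is DIAGONAL in the frame `B` (§1) — hence commutes with `F`, and on the `ρ`-eigenvectors of the `p`-th factor it is the scalar
`ρ̃(u_p) = ±i` prescribed by `Φ′_p` (§2).  §3: the HEAD `isSpecial_auxComplexStructureV_of_frame` and the curve's form
`isSpecial_auxComplexStructureV_curve` (`n = 2`, `M = F`, `j = id`, `B = (w′ | w)`, `v = ι₁ w`) in EXACTLY the `hJsp` binder shape.

## References
* [Deligne1971TravauxShimura] P. Deligne, *Travaux de Shimura* (1971), 4.18 p. 150, 5.11 p. 158.
* [Deligne1979ShimuraVarieties] P. Deligne, *Variétés de Shimura* (1979), Prop. 2.3.10 and 2.3.9 (PDF p. 32 of Milne's translation).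
* [Milne2005ShimuraVarieties] J. S. Milne, *Introduction to Shimura varieties* (2005), Def. 12.5, Rem. 12.6 p. 113, Ex. 12.4 (b) p. 112.
* [MilneCM2006] J. S. Milne, *Complex Multiplication* (2006), Ch. I §1 (CM types and `h_Φ`).
-/

set_option autoImplicit false

noncomputable section

open Matrix NumberField
open scoped TensorProduct ComplexConjugate Classical

namespace Literature.AlgebraicGeometry.ShimuraVarieties

namespace UnitaryCurve

namespace AuxV

open Literature.AlgebraicGeometry.ModuliOfAbelianVarieties
open Literature.AlgebraicGeometry.Motives (CMType)
open Literature.NumberTheory.Automorphic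
open Literature.AlgebraicGeometry.ShimuraVarieties.UnitaryCanonicalModel.Aux (ratBasis realPi realPiEquiv realPi_symm_apply realEmb
  realEmb_apply realEmb_tmul realEmb_iPhiVal iPhi iPhiVal coe_iPhi matrix_eq_of_realEmb_eq map_includeRight_map_realEmb realEmb_eq_embOf
  sum_repr_mul_eq_realEmb sum_repr_mul_eq_conj_realEmb)

/-! ### §1. `s_v` is diagonal in an orthogonal frame through the negative line -/

section Frame

variable {L : Type} [Field L] (M : Type) [Field M] [NumberField M] [IsCMField M] (j : L →+* M) (Φ : CMType M) (τ : L →+* ℂ)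
  {n : ℕ} (H : Matrix (Fin n) (Fin n) L)

/-- `(Xᴴ·K·X)_{kl} = (X e_k)ᴴ·K·(X e_l)`. [cite: Deligne1979ShimuraVarieties, Prop. 2.3.10 (PDF p. 32)] -/
private theorem conjTranspose_mul_mul_apply (X K : Matrix (Fin n) (Fin n) ℂ) (k l : Fin n) :
    (Xᴴ * K * X) k l = star (fun i => X i k) ⬝ᵥ (K *ᵥ fun i => X i l) := by
  rw [Matrix.mul_assoc, Matrix.mul_apply]
  rfl

/-- The `ρ`-image of the `M`-sesquilinear Gram entry: `ρ((ᵗc(B)·H^j·B)_{kl}) = ((B^ρ)ᴴ·H^{ρ∘j}·B^ρ)_{kl}` (rank-`n` copy of ★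
`Aux.map_transpose_map_complexConj_mul_mul`). [cite: Deligne1979ShimuraVarieties, 2.3.9 (PDF p. 32)] -/
theorem map_transpose_map_complexConj_mul_mulV (ρ : M →+* ℂ) (B : Matrix (Fin n) (Fin n) M) (k l : Fin n) :
    ρ (((B.map (IsCMField.complexConj M))ᵀ * H.map j * B) k l) =
      ((B.map ρ)ᴴ * H.map (ρ.comp j) * B.map ρ) k l := by
  simp only [Matrix.mul_apply, Matrix.transpose_apply, Matrix.map_apply, Matrix.conjTranspose_apply, map_sum,
    map_mul, IsCMField.complexEmbedding_complexConj, RingHom.coe_comp, Function.comp_apply, Complex.star_def]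

/-- **`s_ρ` in the frame `B^ρ`** (rank-`n` copy of ★ `Aux.sComp_mul_frame_eq`): at every `ρ ∈ Φ`, `s_ρ·B^ρ = B^ρ·diag(1, …, ε_ρ, …, 1)` with `ε_ρ = −1`
(at the column `p₀`) if `ρ ∘ j = τ` and `1` otherwise — for an `H^j`-orthogonal `M`-frame `B` of `V_M` whose column `b_{p₀}` spans, at the `ρ` over `τ`, the
negative line `ℂv` (★ A1 `reflH_mulVec_self`, `reflH_mulVec_of_orthogonal`). [cite: Deligne1979ShimuraVarieties, Prop. 2.3.10 (PDF p. 32)]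
[cite: Milne2005ShimuraVarieties, Def. 12.5 and Rem. 12.6 p. 113] -/
theorem sCompV_mul_frame_eq (v : Fin n → ℂ) (hv : formH (H.map τ) v ≠ 0) (B : Matrix (Fin n) (Fin n) M) (p₀ : Fin n)
    (hB : ∀ k l : Fin n, k ≠ l → ((B.map (IsCMField.complexConj M))ᵀ * H.map j * B) k l = 0) (ρ : Φ.1)
    (hline : ρ.1.comp j = τ → ∃ c : ℂ, c ≠ 0 ∧ v = c • fun i => ρ.1 (B i p₀)) :
    sCompV M j Φ τ H v ρ * B.map ρ.1 =
      B.map ρ.1 * Matrix.diagonal (fun k : Fin n => if k = p₀ then (if ρ.1.comp j = τ then (-1 : ℂ) else 1) else 1) := by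
  by_cases hρ : ρ.1.comp j = τ
  · obtain ⟨c, hc, hcv⟩ := hline hρ
    -- the columns of `B^ρ`: `b_{p₀} = c⁻¹ v`, the others `H^τ`-orthogonal to `v`
    have hcol₀ : (fun i => B.map ρ.1 i p₀) = c⁻¹ • v := by
      rw [hcv, smul_smul, inv_mul_cancel₀ hc, one_smul]
      rfl
    have horth : ∀ k : Fin n, k ≠ p₀ → star v ⬝ᵥ (H.map τ *ᵥ fun i => B.map ρ.1 i k) = 0 := by
      intro k hk
      have h0 : star (fun i => ρ.1 (B i p₀)) ⬝ᵥ (H.map τ *ᵥ fun i => B.map ρ.1 i k) = 0 := by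
        change star (fun i => B.map ρ.1 i p₀) ⬝ᵥ (H.map τ *ᵥ fun i => B.map ρ.1 i k) = 0
        rw [← conjTranspose_mul_mul_apply, ← hρ, ← map_transpose_map_complexConj_mul_mulV M j H ρ.1 B p₀ k, hB p₀ k hk.symm,
          map_zero]
      rw [hcv, star_smul, smul_dotProduct, h0, smul_zero]
    rw [sCompV_of_eq _ hρ, if_pos hρ]
    apply Matrix.ext
    intro i k
    have hk : (reflH (H.map τ) v * B.map ρ.1) i k = (reflH (H.map τ) v *ᵥ fun l => B.map ρ.1 l k) i := rfl
    rw [hk, Matrix.mul_diagonal]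
    by_cases hkp : k = p₀
    · subst hkp
      have hi := congrFun hcol₀ i
      simp only [Pi.smul_apply, smul_eq_mul] at hi
      rw [if_pos rfl, hcol₀, Matrix.mulVec_smul, reflH_mulVec_self _ hv, hi]
      simp only [Pi.smul_apply, Pi.neg_apply, smul_eq_mul]
      ring
    · rw [if_neg hkp, reflH_mulVec_of_orthogonal _ (horth k hkp), mul_one]
  · have h1 : Matrix.diagonal (fun k : Fin n => if k = p₀ then (if ρ.1.comp j = τ then (-1 : ℂ) else 1) else 1) = 1 := by
      rw [if_neg hρ, ← Matrix.diagonal_one]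
      congr 1
      funext k
      split_ifs <;> rfl
    rw [sCompV_of_ne _ hρ, h1, Matrix.one_mul, Matrix.mul_one]

/-- **`iPhi·s_v` is DIAGONAL in the `M`-frame `B`: `(iPhi·s_v)·B_ℝ = B_ℝ·diag(u)`** in `M_n(ℝ ⊗_ℚ M)`, with `u_p = iPhi` (`p ≠ p₀`) and `u_{p₀} = iPhi·ε`,
`ε ∈ ℝ ⊗_ℚ M` the element with `Φ`-components `−1` at the `ρ` over `τ` and `+1` elsewhere — checked on `Φ`-components (★ `matrix_eq_of_realEmb_eq`,
★ A2 `coe_blockGLV_iPhi_sPhiV_map_embOf_of_mem`).  Rank-`n`, `W₀`-free copy of ★ `Aux.blockGL_iPhi_sPhi_mul_frame_eq`.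
[cite: Deligne1979ShimuraVarieties, Prop. 2.3.10 (PDF p. 32)] [cite: Milne2005ShimuraVarieties, Def. 12.5 and Rem. 12.6 p. 113] -/
theorem blockGLV_iPhi_sPhiV_mul_frame_eq (v : Fin n → ℂ) (hv : formH (H.map τ) v ≠ 0) (B : Matrix (Fin n) (Fin n) M) (p₀ : Fin n)
    (hB : ∀ k l : Fin n, k ≠ l → ((B.map (IsCMField.complexConj M))ᵀ * H.map j * B) k l = 0)
    (hline : ∀ ρ : Φ.1, ρ.1.comp j = τ → ∃ c : ℂ, c ≠ 0 ∧ v = c • fun i => ρ.1 (B i p₀)) :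
    ((blockGLV (ℝ ⊗[ℚ] M) (iPhi M Φ, sPhiV M j Φ τ H v) : GL (Fin n) (ℝ ⊗[ℚ] M)) : Matrix (Fin n) (Fin n) (ℝ ⊗[ℚ] M)) *
        B.map (Algebra.TensorProduct.includeRight : M →ₐ[ℚ] ℝ ⊗[ℚ] M) =
      B.map (Algebra.TensorProduct.includeRight : M →ₐ[ℚ] ℝ ⊗[ℚ] M) *
        Matrix.diagonal (fun p : Fin n => iPhiVal M Φ *
          (if p = p₀ then (realPiEquiv M Φ).symm (fun φ => if φ.1.comp j = τ then (-1 : ℂ) else 1) else 1)) := by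
  apply matrix_eq_of_realEmb_eq M Φ
  rintro ⟨ρ, hρΦ⟩
  have hd : (fun p : Fin n => realEmb M Φ ⟨ρ, hρΦ⟩ (iPhiVal M Φ *
        (if p = p₀ then (realPiEquiv M Φ).symm (fun φ => if φ.1.comp j = τ then (-1 : ℂ) else 1) else 1))) =
      fun p => Complex.I * (if p = p₀ then (if ρ.comp j = τ then (-1 : ℂ) else 1) else 1) := by
    funext p
    rw [map_mul, realEmb_iPhiVal]
    congr 1
    by_cases hp : p = p₀
    · rw [if_pos hp, if_pos hp, realEmb_apply, realPi_symm_apply]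
    · rw [if_neg hp, if_neg hp, map_one]
  have hε := sCompV_mul_frame_eq M j Φ τ H v hv B p₀ hB ⟨ρ, hρΦ⟩ (hline ⟨ρ, hρΦ⟩)
  have hL : (((blockGLV (ℝ ⊗[ℚ] M) (iPhi M Φ, sPhiV M j Φ τ H v) : GL (Fin n) (ℝ ⊗[ℚ] M)) :
        Matrix (Fin n) (Fin n) (ℝ ⊗[ℚ] M)).map (realEmb M Φ ⟨ρ, hρΦ⟩)) = Complex.I • sCompV M j Φ τ H v ⟨ρ, hρΦ⟩ := by
    rw [realEmb_eq_embOf M Φ ⟨ρ, hρΦ⟩]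
    exact coe_blockGLV_iPhi_sPhiV_map_embOf_of_mem M j Φ τ H hρΦ v
  rw [Matrix.map_mul, Matrix.map_mul, map_includeRight_map_realEmb, hL, Matrix.diagonal_map (map_zero _)]
  change Complex.I • sCompV M j Φ τ H v ⟨ρ, hρΦ⟩ * B.map ρ = B.map ρ * Matrix.diagonal (fun p => realEmb M Φ ⟨ρ, hρΦ⟩ _)
  rw [hd]
  calc Complex.I • sCompV M j Φ τ H v ⟨ρ, hρΦ⟩ * B.map ρ
      = Complex.I • (sCompV M j Φ τ H v ⟨ρ, hρΦ⟩ * B.map ρ) := Matrix.smul_mul _ _ _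
    _ = Complex.I • (B.map ρ * Matrix.diagonal (fun k : Fin n => if k = p₀ then (if ρ.comp j = τ then (-1 : ℂ) else 1) else 1)) := by
        rw [hε]
    _ = B.map ρ * (Complex.I • Matrix.diagonal (fun k : Fin n => if k = p₀ then (if ρ.comp j = τ then (-1 : ℂ) else 1) else 1)) :=
        (Matrix.mul_smul _ _ _).symm
    _ = B.map ρ * Matrix.diagonal (fun p => Complex.I * (if p = p₀ then (if ρ.comp j = τ then (-1 : ℂ) else 1) else 1)) := by
        rw [← Matrix.diagonal_smul]
        rfl

end Frame

/-! ### §2. `J_Φ(v)` lies in the real span of the CM action (index-`Fin n` copies of ★ `UnitaryAuxiliarySpecialPairSpan`) -/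

section Span

variable {L : Type} [Field L] {M : Type} [Field M] [NumberField M] [IsCMField M] {j : L →+* M}
  {n : ℕ} {H : Matrix (Fin n) (Fin n) L} {ξ : M} {g : ℕ} {δ : Fin g → ℕ}

/-- The action matrix of a PINNED CM structure base-changed to `R`: `actMatrix c x ⊗ R = P_R · Res_{R⊗M/R}((B·diag(x)·B⁻¹) ⊗ 1) · Q_R`
(★ FILE A `actMatrix_eq_frame_of_pinnedV` + ★ `resMatrix_map_includeRight`). [cite: Deligne1971TravauxShimura, 4.9 p. 147 and 4.18 p. 150] -/
theorem actMatrix_map_eq_of_pinnedV (R : Type) [CommRing R] [Algebra ℚ R] (Fr : SymplecticFrameV M j H ξ g δ) (B : GL (Fin n) M)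
    (c : CMStructure g δ (Fin n) (fun _ => M))
    (hc : ∀ (x : Fin n → M) (p : Fin n) (m : M),
      c.act x (Fr.β (m • (B : Matrix (Fin n) (Fin n) M) *ᵥ Pi.single p 1)) = Fr.β ((x p * m) • (B : Matrix (Fin n) (Fin n) M) *ᵥ Pi.single p 1))
    (x : Fin n → M) :
    (c.actMatrix x).map (algebraMap ℚ R) =
      framePVR R Fr * resMatrix (Algebra.TensorProduct.basis R (ratBasis M))
        ((B.val * Matrix.diagonal x * (B⁻¹).val).map (Algebra.TensorProduct.includeRight : M →ₐ[ℚ] R ⊗[ℚ] M)) *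
        frameQVR R Fr := by
  rw [actMatrix_eq_frame_of_pinnedV Fr B c hc, Matrix.map_mul, Matrix.map_mul, resMatrix_map_includeRight]
  rfl

/-- `J_Φ(v)` as a matrix: `P_ℝ · Res(iPhi·s_v) · Q_ℝ`. [cite: Deligne1979ShimuraVarieties, Prop. 2.3.10 (PDF p. 32)] -/
theorem auxComplexStructureV_eq_frame (Fr : SymplecticFrameV M j H ξ g δ) (τ : L →+* ℂ) (Φ : CMType M) (v : Fin n → ℂ) :
    auxComplexStructureV Fr τ Φ v =
      framePVR ℝ Fr * resMatrix (Algebra.TensorProduct.basis ℝ (ratBasis M))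
        ((blockGLV (ℝ ⊗[ℚ] M) (iPhi M Φ, sPhiV M j Φ τ H v) : GL (Fin n) (ℝ ⊗[ℚ] M)) : Matrix (Fin n) (Fin n) (ℝ ⊗[ℚ] M)) *
        frameQVR ℝ Fr := by
  rw [auxComplexStructureV_def, auxRepV, MonoidHom.comp_apply, MonoidHom.comp_apply, coe_conjRect, coe_resGL]

omit [IsCMField M] in
/-- `diagonal` is additive over finite sums. [cite: Deligne1971TravauxShimura, 4.18 p. 150] -/
private theorem diagonal_sum'' {m κ α : Type} [Fintype κ] [DecidableEq m] [AddCommMonoid α] (f : κ → m → α) :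
    Matrix.diagonal (∑ k, f k) = ∑ k, Matrix.diagonal (f k) :=
  map_sum (Matrix.diagonalAddMonoidHom m α) f Finset.univ

omit [IsCMField M] in
/-- `Pi.single p` is additive over finite sums. [cite: Deligne1971TravauxShimura, 4.18 p. 150] -/
private theorem single_sum'' {m κ α : Type} [Fintype κ] [DecidableEq m] [AddCommMonoid α] (p : m) (f : κ → α) :
    (Pi.single p (∑ k, f k) : m → α) = ∑ k, (Pi.single p (f k) : m → α) :=
  map_sum (AddMonoidHom.single (fun _ : m => α) p) f Finset.univ

omit [IsCMField M] in
/-- A frame-diagonal matrix is a combination of the frame projectors: if `A·B_ℝ = B_ℝ·diag(u)` then `A = Σ_{p,k} u_{p,k} · (B·diag(e_p b_k)·B⁻¹) ⊗ 1`,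
`u_p = Σ_k u_{p,k} (1 ⊗ b_k)` (index-`Fin n` copy of ★ `Aux.eq_sum_smul_frameDiag_of_mul_eq`). [cite: Deligne1971TravauxShimura, 4.18 p. 150] -/
theorem eq_sum_smul_frameDiag_of_mul_eqV (B : GL (Fin n) M) (A : Matrix (Fin n) (Fin n) (ℝ ⊗[ℚ] M)) (u : Fin n → ℝ ⊗[ℚ] M)
    (hu : A * B.val.map (Algebra.TensorProduct.includeRight : M →ₐ[ℚ] ℝ ⊗[ℚ] M) =
      B.val.map (Algebra.TensorProduct.includeRight : M →ₐ[ℚ] ℝ ⊗[ℚ] M) * Matrix.diagonal u) :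
    A = ∑ p : Fin n, ∑ k : Fin (Module.finrank ℚ M),
      (Algebra.TensorProduct.basis ℝ (ratBasis M)).repr (u p) k •
        (B.val * Matrix.diagonal (Pi.single p (ratBasis M k)) * (B⁻¹).val).map
          (Algebra.TensorProduct.includeRight : M →ₐ[ℚ] ℝ ⊗[ℚ] M) := by
  set ι : M →ₐ[ℚ] ℝ ⊗[ℚ] M := Algebra.TensorProduct.includeRight with hι
  set bR := Algebra.TensorProduct.basis ℝ (ratBasis M) with hbR
  have hPPinv : B.val.map ι * (B⁻¹).val.map ι = 1 := by
    rw [← Matrix.map_mul, Units.mul_inv, Matrix.map_one ι (map_zero ι) (map_one ι)]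
  have hdiag : Matrix.diagonal u = ∑ p : Fin n, ∑ k : Fin (Module.finrank ℚ M),
      bR.repr (u p) k • Matrix.diagonal (Pi.single p (ι (ratBasis M k))) := by
    have h1 : ∀ p : Fin n, ∑ k : Fin (Module.finrank ℚ M),
        bR.repr (u p) k • Matrix.diagonal (Pi.single p (ι (ratBasis M k))) = Matrix.diagonal (Pi.single p (u p)) := by
      intro p
      have h2 : ∀ k, bR.repr (u p) k • Matrix.diagonal (Pi.single p (ι (ratBasis M k))) =
          Matrix.diagonal (Pi.single p (bR.repr (u p) k • bR k)) := by
        intro k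
        rw [← Matrix.diagonal_smul, ← Pi.single_smul', hbR, Algebra.TensorProduct.basis_apply, hι,
          Algebra.TensorProduct.includeRight_apply]
      simp_rw [h2]
      rw [← diagonal_sum'', ← single_sum'', bR.sum_repr (u p)]
    simp_rw [h1]
    rw [← diagonal_sum'', Finset.univ_sum_single]
  have hA : A = B.val.map ι * Matrix.diagonal u * (B⁻¹).val.map ι := by
    calc A = A * (B.val.map ι * (B⁻¹).val.map ι) := by rw [hPPinv, Matrix.mul_one]
      _ = B.val.map ι * Matrix.diagonal u * (B⁻¹).val.map ι := by rw [← Matrix.mul_assoc, hu]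
  rw [hA, hdiag, Finset.mul_sum, Finset.sum_mul]
  refine Finset.sum_congr rfl fun p _ => ?_
  rw [Finset.mul_sum, Finset.sum_mul]
  refine Finset.sum_congr rfl fun k _ => ?_
  have hs : (fun q : Fin n => ι ((Pi.single p (ratBasis M k) : Fin n → M) q)) = Pi.single p (ι (ratBasis M k)) := by
    funext q
    by_cases h : q = p
    · subst h; simp
    · simp [Pi.single_eq_of_ne h]
  rw [Matrix.mul_smul, Matrix.smul_mul, Matrix.map_mul, Matrix.map_mul, Matrix.diagonal_map (map_zero ι), hs]

/-- **KEY IDENTITY: `J_Φ(v)` lies in the real span of the CM action.**  If `(iPhi·s_v)·B_ℝ = B_ℝ·diag(u)` for the frame `B` pinning the CM structure `c`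
(§1 `blockGLV_iPhi_sPhiV_mul_frame_eq`), then `J = Σ_{p,k} u_{p,k} · act(e_p b_k) ⊗ ℝ`: the complex structure is the image of `u ∈ F ⊗ ℝ = (ℝ ⊗_ℚ M)^{Fin n}`
under the CM action — Deligne's «`h` se factorise par `T_ℝ ⊂ G_ℝ`», `T = Res F^×` (index-`Fin n` copy of ★ `Aux.auxComplexStructure_eq_sum_actMatrix`).
[cite: Deligne1971TravauxShimura, 4.18 p. 150] [cite: Deligne1979ShimuraVarieties, Prop. 2.3.10 (PDF p. 32)] -/
theorem auxComplexStructureV_eq_sum_actMatrix (Fr : SymplecticFrameV M j H ξ g δ) (τ : L →+* ℂ) (Φ : CMType M) (v : Fin n → ℂ)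
    (B : GL (Fin n) M) (c : CMStructure g δ (Fin n) (fun _ => M))
    (hc : ∀ (y : Fin n → M) (p : Fin n) (m : M),
      c.act y (Fr.β (m • (B : Matrix (Fin n) (Fin n) M) *ᵥ Pi.single p 1)) = Fr.β ((y p * m) • (B : Matrix (Fin n) (Fin n) M) *ᵥ Pi.single p 1))
    (u : Fin n → ℝ ⊗[ℚ] M)
    (hu : ((blockGLV (ℝ ⊗[ℚ] M) (iPhi M Φ, sPhiV M j Φ τ H v) : GL (Fin n) (ℝ ⊗[ℚ] M)) : Matrix (Fin n) (Fin n) (ℝ ⊗[ℚ] M)) *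
        B.val.map (Algebra.TensorProduct.includeRight : M →ₐ[ℚ] ℝ ⊗[ℚ] M) =
      B.val.map (Algebra.TensorProduct.includeRight : M →ₐ[ℚ] ℝ ⊗[ℚ] M) * Matrix.diagonal u) :
    auxComplexStructureV Fr τ Φ v = ∑ p : Fin n, ∑ k : Fin (Module.finrank ℚ M),
      (Algebra.TensorProduct.basis ℝ (ratBasis M)).repr (u p) k • (c.actMatrix (Pi.single p (ratBasis M k))).map (algebraMap ℚ ℝ) := by
  rw [auxComplexStructureV_eq_frame, eq_sum_smul_frameDiag_of_mul_eqV B _ u hu, map_sum, Matrix.mul_sum, Matrix.sum_mul]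
  refine Finset.sum_congr rfl fun p _ => ?_
  rw [map_sum, Matrix.mul_sum, Matrix.sum_mul]
  refine Finset.sum_congr rfl fun k _ => ?_
  rw [resMatrix_smul, Matrix.mul_smul, Matrix.smul_mul, actMatrix_map_eq_of_pinnedV ℝ Fr B c hc]

/-- **`J` commutes with the CM action** (it lies in its real span and `F` is commutative; index-`Fin n` copy of ★
`Aux.auxComplexStructure_mul_actMatrix_comm`). [cite: Deligne1971TravauxShimura, 4.18 p. 150] -/
theorem auxComplexStructureV_mul_actMatrix_comm (Fr : SymplecticFrameV M j H ξ g δ) (τ : L →+* ℂ) (Φ : CMType M) (v : Fin n → ℂ)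
    (B : GL (Fin n) M) (c : CMStructure g δ (Fin n) (fun _ => M))
    (hc : ∀ (y : Fin n → M) (p : Fin n) (m : M),
      c.act y (Fr.β (m • (B : Matrix (Fin n) (Fin n) M) *ᵥ Pi.single p 1)) = Fr.β ((y p * m) • (B : Matrix (Fin n) (Fin n) M) *ᵥ Pi.single p 1))
    (u : Fin n → ℝ ⊗[ℚ] M)
    (hu : ((blockGLV (ℝ ⊗[ℚ] M) (iPhi M Φ, sPhiV M j Φ τ H v) : GL (Fin n) (ℝ ⊗[ℚ] M)) : Matrix (Fin n) (Fin n) (ℝ ⊗[ℚ] M)) *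
        B.val.map (Algebra.TensorProduct.includeRight : M →ₐ[ℚ] ℝ ⊗[ℚ] M) =
      B.val.map (Algebra.TensorProduct.includeRight : M →ₐ[ℚ] ℝ ⊗[ℚ] M) * Matrix.diagonal u)
    (y : Fin n → M) :
    auxComplexStructureV Fr τ Φ v * (c.actMatrix y).map (algebraMap ℚ ℝ) =
      (c.actMatrix y).map (algebraMap ℚ ℝ) * auxComplexStructureV Fr τ Φ v := by
  rw [auxComplexStructureV_eq_sum_actMatrix Fr τ Φ v B c hc u hu, Matrix.sum_mul, Matrix.mul_sum]
  refine Finset.sum_congr rfl fun p _ => ?_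
  rw [Matrix.sum_mul, Matrix.mul_sum]
  refine Finset.sum_congr rfl fun k _ => ?_
  rw [Matrix.smul_mul, Matrix.mul_smul, ← Matrix.map_mul, ← Matrix.map_mul, ← CMStructure.actMatrix_mul,
    ← CMStructure.actMatrix_mul, mul_comm]

/-- Off the block: a simultaneous eigenvector of the `i`-th factor is killed by the other factors (`e_p·e_i = 0`; index-`Fin n` copy of ★
`Aux.actMatrix_single_mulVec_eq_zero_of_ne`). [cite: Deligne1971TravauxShimura, 4.18 p. 150] -/
theorem actMatrix_single_mulVec_eq_zero_of_neV (c : CMStructure g δ (Fin n) (fun _ => M)) {i p : Fin n} (hpi : p ≠ i) (ρ : M →+* ℂ)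
    (v : Fin g ⊕ Fin g → ℂ) (hv : ∀ y : M, (c.actMatrix (Pi.single i y)).map (algebraMap ℚ ℂ) *ᵥ v = ρ y • v) (y : M) :
    (c.actMatrix (Pi.single p y)).map (algebraMap ℚ ℂ) *ᵥ v = 0 := by
  have h1 : v = (c.actMatrix (Pi.single i 1)).map (algebraMap ℚ ℂ) *ᵥ v := by rw [hv 1, map_one, one_smul]
  have h0 : (Pi.single p y : Fin n → M) * Pi.single i 1 = 0 := by
    funext q
    rw [Pi.mul_apply, Pi.zero_apply]
    by_cases hq : q = i
    · subst hq
      rw [Pi.single_eq_of_ne (fun h => hpi h.symm), zero_mul]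
    · rw [Pi.single_eq_of_ne hq, mul_zero]
  conv_lhs => rw [h1]
  rw [Matrix.mulVec_mulVec, ← Matrix.map_mul, ← CMStructure.actMatrix_mul, h0, CMStructure.actMatrix_def, map_zero,
    map_zero, Matrix.map_zero _ (map_zero _), Matrix.zero_mulVec]

omit [IsCMField M] in
/-- A multiplicative map pulls a scalar out of an entrywise map. [cite: Deligne1971TravauxShimura, 4.18 p. 150] -/
private theorem smul_map'' {S S' : Type} [CommRing S] [CommRing S'] {F' : Type} [FunLike F' S S'] [MulHomClass F' S S']
    {m m' : Type} (f : F') (r : S) (A : Matrix m m' S) : (r • A).map f = f r • A.map f := by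
  ext a b
  simp [map_mul]

/-- **`J_ℂ` on a simultaneous eigenvector of the `i`-th factor with eigencharacter `ρ` is the scalar `ρ̃(u_i) = Σ_k u_{i,k} ρ(b_k)`** (index-`Fin n` copy of
★ `Aux.auxComplexStructure_map_mulVec_eq`). [cite: Deligne1971TravauxShimura, 4.18 p. 150] -/
theorem auxComplexStructureV_map_mulVec_eq (Fr : SymplecticFrameV M j H ξ g δ) (τ : L →+* ℂ) (Φ : CMType M) (v : Fin n → ℂ)
    (B : GL (Fin n) M) (c : CMStructure g δ (Fin n) (fun _ => M))
    (hc : ∀ (y : Fin n → M) (p : Fin n) (m : M),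
      c.act y (Fr.β (m • (B : Matrix (Fin n) (Fin n) M) *ᵥ Pi.single p 1)) = Fr.β ((y p * m) • (B : Matrix (Fin n) (Fin n) M) *ᵥ Pi.single p 1))
    (u : Fin n → ℝ ⊗[ℚ] M)
    (hu : ((blockGLV (ℝ ⊗[ℚ] M) (iPhi M Φ, sPhiV M j Φ τ H v) : GL (Fin n) (ℝ ⊗[ℚ] M)) : Matrix (Fin n) (Fin n) (ℝ ⊗[ℚ] M)) *
        B.val.map (Algebra.TensorProduct.includeRight : M →ₐ[ℚ] ℝ ⊗[ℚ] M) =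
      B.val.map (Algebra.TensorProduct.includeRight : M →ₐ[ℚ] ℝ ⊗[ℚ] M) * Matrix.diagonal u)
    (i : Fin n) (ρ : M →+* ℂ) (v' : Fin g ⊕ Fin g → ℂ)
    (hv : ∀ y : M, (c.actMatrix (Pi.single i y)).map (algebraMap ℚ ℂ) *ᵥ v' = ρ y • v') :
    (auxComplexStructureV Fr τ Φ v).map (algebraMap ℝ ℂ) *ᵥ v' =
      (∑ k : Fin (Module.finrank ℚ M), (((Algebra.TensorProduct.basis ℝ (ratBasis M)).repr (u i) k : ℝ) : ℂ) * ρ (ratBasis M k)) • v' := by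
  have hqc : (algebraMap ℝ ℂ : ℝ → ℂ) ∘ (algebraMap ℚ ℝ : ℚ → ℝ) = (algebraMap ℚ ℂ : ℚ → ℂ) := by
    funext q
    simp
  rw [auxComplexStructureV_eq_sum_actMatrix Fr τ Φ v B c hc u hu, ← RingHom.mapMatrix_apply, map_sum, Matrix.sum_mulVec,
    Finset.sum_eq_single i]
  · rw [map_sum, Matrix.sum_mulVec, Finset.sum_smul]
    refine Finset.sum_congr rfl fun k _ => ?_
    rw [RingHom.mapMatrix_apply, smul_map'', Matrix.map_map, hqc, Matrix.smul_mulVec, hv, smul_smul]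
    rfl
  · intro p _ hpi
    rw [map_sum, Matrix.sum_mulVec]
    refine Finset.sum_eq_zero fun k _ => ?_
    rw [RingHom.mapMatrix_apply, smul_map'', Matrix.map_map, hqc, Matrix.smul_mulVec,
      actMatrix_single_mulVec_eq_zero_of_neV c hpi ρ v' hv, smul_zero]
  · intro h
    exact absurd (Finset.mem_univ i) h

end Span

/-! ### §3. HEAD: the special pair `(c_B, J_Φ(v))` with CM types `(Φ, …, Φ^τ̄, …, Φ)` -/

section Special

variable {L : Type} [Field L] {M : Type} [Field M] [NumberField M] [IsCMField M] {j : L →+* M}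
  {n : ℕ} {H : Matrix (Fin n) (Fin n) L} {ξ : M} {g : ℕ} {δ : Fin g → ℕ}

/-- **THE SPECIAL PAIR OF A NEGATIVE LINE, ANY RANK** ([Deligne1971TravauxShimura] 4.18 and 5.11; [Deligne1979ShimuraVarieties] Prop. 2.3.10;
[Milne2005ShimuraVarieties] Def. 12.5 / Rem. 12.6 p. 113, Ex. 12.4 (b) p. 112; rank-`n`, `W₀`-free copy of ★ `Aux.isSpecial_of_frame_spec_of_line`).
Let `B ∈ GL_n(M)` be an `H^j`-ORTHOGONAL `M`-frame of `V_M` whose column `b_{p₀}` spans the negative line `ℂv` at the embeddings of `M` over `τ`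
(`v = c·ρ(b_{p₀})`, `c ≠ 0`), `q_{H^τ}(v) ≠ 0`, and let `c` be a CM structure pinned on the frame through `β` (★ FILE A `exists_cmStructureV_of_orthogonal`).
Then `(c, J_Φ(v))` — `J_Φ(v) = ` ★ E2 `auxComplexStructureV Fr τ Φ v`, any proof `hJ` that it lies in `S^±` — is a SPECIAL PAIR (★ `CMStructure.IsSpecial`)
with CM types `Φ′_p = Φ` for `p ≠ p₀` and the SWAPPED type `Φ′_{p₀} = Φ^τ̄ = (Φ ∖ {ρ | ρ∘j = τ}) ∪ {ρ | ρ∘j = τ̄}` (any `Φ′` with these fibres):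
`J` commutes with `F = M^{Fin n}` (it is the image of `(iPhi, …, iPhi·ε, …, iPhi) ∈ F ⊗ ℝ`), and on the `ρ`-eigenline of the `p`-th factor `J_ℂ` is
`+i` iff `ρ ∈ Φ′_p`.  Hypothesis `hτ : τ̄ ≠ τ`. [cite: Deligne1971TravauxShimura, 4.18 p. 150 and 5.11 p. 158]
[cite: Deligne1979ShimuraVarieties, Prop. 2.3.10 (PDF p. 32)] [cite: Milne2005ShimuraVarieties, Def. 12.5, Rem. 12.6 p. 113 and Ex. 12.4 (b) p. 112] -/
theorem isSpecial_auxComplexStructureV_of_frame (Fr : SymplecticFrameV M j H ξ g δ) (τ : L →+* ℂ) (Φ : CMType M)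
    (hτ : ComplexEmbedding.conjugate τ ≠ τ) (v : Fin n → ℂ) (hv : formH (H.map τ) v ≠ 0)
    (B : GL (Fin n) M) (p₀ : Fin n)
    (hB : ∀ k l : Fin n, k ≠ l →
      (((B : Matrix (Fin n) (Fin n) M).map (IsCMField.complexConj M))ᵀ * H.map j * (B : Matrix (Fin n) (Fin n) M)) k l = 0)
    (hline : ∀ ρ : Φ.1, ρ.1.comp j = τ → ∃ c : ℂ, c ≠ 0 ∧ v = c • fun i => ρ.1 ((B : Matrix (Fin n) (Fin n) M) i p₀))
    (c : CMStructure g δ (Fin n) (fun _ => M))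
    (hc : ∀ (y : Fin n → M) (p : Fin n) (m : M),
      c.act y (Fr.β (m • (B : Matrix (Fin n) (Fin n) M) *ᵥ Pi.single p 1)) = Fr.β ((y p * m) • (B : Matrix (Fin n) (Fin n) M) *ᵥ Pi.single p 1))
    (hJ : auxComplexStructureV Fr τ Φ v ∈ C0pm δ)
    (Φ' : Fin n → CMType M) (hΦ'₁ : ∀ p, p ≠ p₀ → Φ' p = Φ)
    (hΦ'₂ : ∀ ρ : M →+* ℂ, ρ ∈ (Φ' p₀).1 ↔ (ρ ∈ Φ.1 ∧ ρ.comp j ≠ τ) ∨ ρ.comp j = ComplexEmbedding.conjugate τ) :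
    c.IsSpecial ⟨auxComplexStructureV Fr τ Φ v, hJ⟩ Φ' := by
  have hinv := ComplexEmbedding.involutive_conjugate L
  have hu := blockGLV_iPhi_sPhiV_mul_frame_eq M j Φ τ H v hv (B : Matrix (Fin n) (Fin n) M) p₀ hB hline
  set u : Fin n → ℝ ⊗[ℚ] M := fun p => iPhiVal M Φ *
    (if p = p₀ then (realPiEquiv M Φ).symm (fun φ => if φ.1.comp j = τ then (-1 : ℂ) else 1) else 1) with hu_def
  -- the `Φ`-components of `u`
  have hval0 : ∀ (φ : Φ.1) (p : Fin n), p ≠ p₀ → realEmb M Φ φ (u p) = Complex.I := by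
    intro φ p hp
    rw [hu_def]
    simp only [if_neg hp, mul_one, realEmb_iPhiVal]
  have hu2 : u p₀ = iPhiVal M Φ * (realPiEquiv M Φ).symm (fun φ => if φ.1.comp j = τ then (-1 : ℂ) else 1) := by
    rw [hu_def]
    dsimp only
    rw [if_pos rfl]
  have hval1 : ∀ φ : Φ.1, φ.1.comp j = τ → realEmb M Φ φ (u p₀) = -Complex.I := by
    intro φ hφ
    rw [hu2, map_mul, realEmb_iPhiVal, realEmb_apply, realPi_symm_apply, if_pos hφ, mul_neg, mul_one]
  have hval2 : ∀ φ : Φ.1, φ.1.comp j ≠ τ → realEmb M Φ φ (u p₀) = Complex.I := by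
    intro φ hφ
    rw [hu2, map_mul, realEmb_iPhiVal, realEmb_apply, realPi_symm_apply, if_neg hφ, mul_one]
  refine ⟨fun y => ?_, fun i ρ v' hv' => ?_⟩
  · exact auxComplexStructureV_mul_actMatrix_comm Fr τ Φ v B c hc u hu y
  · have hJv : (auxComplexStructureV Fr τ Φ v).map (algebraMap ℝ ℂ) *ᵥ v' =
        (∑ k, (((Algebra.TensorProduct.basis ℝ (ratBasis M)).repr (u i) k : ℝ) : ℂ) * ρ (ratBasis M k)) • v' :=
      auxComplexStructureV_map_mulVec_eq Fr τ Φ v B c hc u hu i ρ v' hv'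
    change (ρ ∈ (Φ' i).1 → (auxComplexStructureV Fr τ Φ v).map (algebraMap ℝ ℂ) *ᵥ v' = Complex.I • v') ∧
      (ρ ∉ (Φ' i).1 → (auxComplexStructureV Fr τ Φ v).map (algebraMap ℝ ℂ) *ᵥ v' = (-Complex.I) • v')
    by_cases hρ : ρ ∈ Φ.1
    · rw [sum_repr_mul_eq_realEmb Φ ⟨ρ, hρ⟩ (u i)] at hJv
      by_cases hi : i = p₀
      · subst hi
        constructor
        · intro hmem
          rw [hΦ'₂] at hmem
          have hne : ρ.comp j ≠ τ := by
            rcases hmem with ⟨_, hne⟩ | heq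
            · exact hne
            · intro h
              rw [h] at heq
              exact hτ heq.symm
          rwa [hval2 ⟨ρ, hρ⟩ hne] at hJv
        · intro hnot
          rw [hΦ'₂, not_or] at hnot
          have heq : ρ.comp j = τ := by
            by_contra hne
            exact hnot.1 ⟨hρ, hne⟩
          rwa [hval1 ⟨ρ, hρ⟩ heq] at hJv
      · rw [hval0 ⟨ρ, hρ⟩ i hi] at hJv
        rw [hΦ'₁ i hi]
        exact ⟨fun _ => hJv, fun hnot => absurd hρ hnot⟩
    · have hρ' : ComplexEmbedding.conjugate ρ ∈ Φ.1 := by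
        by_contra h'
        exact hρ ((Φ.2 ρ).2 h')
      rw [sum_repr_mul_eq_conj_realEmb Φ ρ hρ' (u i)] at hJv
      by_cases hi : i = p₀
      · subst hi
        have hiff : (ComplexEmbedding.conjugate ρ).comp j = τ ↔ ρ.comp j = ComplexEmbedding.conjugate τ := by
          constructor
          · intro h
            rw [← h]
            exact (hinv (ρ.comp j)).symm
          · intro h
            change ComplexEmbedding.conjugate (ρ.comp j) = τ
            rw [h]
            exact hinv τ
        constructor
        · intro hmem
          rw [hΦ'₂] at hmem
          have heq : ρ.comp j = ComplexEmbedding.conjugate τ := by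
            rcases hmem with ⟨hmemΦ, _⟩ | heq
            · exact absurd hmemΦ hρ
            · exact heq
          rw [hval1 ⟨ComplexEmbedding.conjugate ρ, hρ'⟩ (hiff.2 heq)] at hJv
          rw [hJv, map_neg, Complex.conj_I, neg_neg]
        · intro hnot
          rw [hΦ'₂, not_or] at hnot
          have hne : ¬ (ComplexEmbedding.conjugate ρ).comp j = τ := fun h => hnot.2 (hiff.1 h)
          rw [hval2 ⟨ComplexEmbedding.conjugate ρ, hρ'⟩ hne] at hJv
          rw [hJv, Complex.conj_I]
      · rw [hval0 ⟨ComplexEmbedding.conjugate ρ, hρ'⟩ i hi] at hJv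
        rw [hΦ'₁ i hi]
        refine ⟨fun hmem => absurd hmem hρ, fun _ => ?_⟩
        rw [hJv, Complex.conj_I]

/-- **THE CURVE'S SPECIAL PAIR — the `hJsp` clause of ★ `exists_sliceField_siegelRecipDatum`, discharged** (`n = 2`, `M = F`, `j = id`, `H = J⋆`,
`τ = ι₁`, frame `b = (w′ | w)` with `w′ ⟂_{J⋆} w`, `v = ι₁ w` negative, `J⋆` hermitian, `p₀ = 1`, types `Φ′ 0 = Φ ∋ ι₁` and
`Φ′ 1 = Φ^ῑ₁ = (Φ ∖ {ι₁}) ∪ {ῑ₁}`): `(c_b, J_Φ(ι₁ w))` is a CM special pair. [cite: Deligne1971TravauxShimura, 5.11 p. 158]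
[cite: Milne2005ShimuraVarieties, Def. 12.5 p. 113 and Ex. 12.4 (b) p. 112] -/
theorem isSpecial_auxComplexStructureV_curve {F : Type} [Field F] [NumberField F] [IsCMField F] (ι₁ : F →+* ℂ)
    (Jstar : Matrix (Fin 2) (Fin 2) F) (hJ : (Jstar.map (IsCMField.complexConj F))ᵀ = Jstar) (Φ : CMType F) {ξ : F} {g : ℕ}
    {δ : Fin g → ℕ} (Fr : SymplecticFrameV F (RingHom.id F) Jstar ξ g δ)
    (hJC : ∀ v' : Fin 2 → ℂ, v' ∈ negCone (Jstar.map ι₁) → auxComplexStructureV Fr ι₁ Φ v' ∈ C0pm δ)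
    (w : Fin 2 → F) (hw : (fun i => ι₁ (w i)) ∈ negCone (Jstar.map ι₁)) (b : GL (Fin 2) F)
    (hb1 : (fun i => (b : Matrix (Fin 2) (Fin 2) F) i 1) = w)
    (hperp : hermForm (cmConjRingHom F) Jstar (fun i => (b : Matrix (Fin 2) (Fin 2) F) i 0) w = 0)
    (c : CMStructure g δ (Fin 2) (fun _ => F))
    (hc : ∀ (x : Fin 2 → F) (p : Fin 2) (m : F),
      c.act x (Fr.β (m • (b : Matrix (Fin 2) (Fin 2) F) *ᵥ Pi.single p 1)) = Fr.β ((x p * m) • (b : Matrix (Fin 2) (Fin 2) F) *ᵥ Pi.single p 1))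
    (Φ' : Fin 2 → CMType F) (h0 : Φ' 0 = Φ)
    (h1 : ∀ ρ : F →+* ℂ, ρ ∈ (Φ' 1).1 ↔ (ρ ∈ Φ.1 ∧ ρ ≠ ι₁) ∨ ρ = ComplexEmbedding.conjugate ι₁) :
    c.IsSpecial ⟨auxComplexStructureV Fr ι₁ Φ (fun i => ι₁ (w i)), hJC _ hw⟩ Φ' := by
  have hι₁ : ComplexEmbedding.conjugate ι₁ ≠ ι₁ := fun h =>
    IsTotallyComplex.complexEmbedding_not_isReal ι₁ (ComplexEmbedding.isReal_iff.mpr h)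
  have hv : formH (Jstar.map ι₁) (fun i => ι₁ (w i)) ≠ 0 := formH_ne_zero_of_mem_negCone _ hw
  -- the frame's Gram matrix is diagonal (`J⋆` hermitian, `w′ ⟂ w`)
  have hJ' : ∀ i k, cmConjRingHom F (Jstar i k) = Jstar k i :=
    UnitaryCanonicalModel.conj_apply_eq_of_transpose_map_eq F Jstar hJ
  have hperp' : hermForm (cmConjRingHom F) Jstar w (fun i => (b : Matrix (Fin 2) (Fin 2) F) i 0) = 0 := by
    rw [UnitaryCanonicalModel.hermForm_conj_symm F Jstar hJ', hperp, map_zero]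
  have hgram : ∀ i k : Fin 2, (((b : Matrix (Fin 2) (Fin 2) F).map (cmConjRingHom F))ᵀ * Jstar * (b : Matrix (Fin 2) (Fin 2) F)) i k =
      hermForm (cmConjRingHom F) Jstar (fun l => (b : Matrix (Fin 2) (Fin 2) F) l i) (fun l => (b : Matrix (Fin 2) (Fin 2) F) l k) := by
    intro i k
    simp only [Matrix.mul_apply, Matrix.transpose_apply, Matrix.map_apply, hermForm, dotProduct, Matrix.mulVec,
      Function.comp_apply, Finset.sum_mul, Finset.mul_sum, mul_assoc]
    rw [Finset.sum_comm]
  have hB : ∀ i k : Fin 2, i ≠ k →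
      (((b : Matrix (Fin 2) (Fin 2) F).map (IsCMField.complexConj F))ᵀ * Jstar.map (RingHom.id F) * (b : Matrix (Fin 2) (Fin 2) F)) i k = 0 := by
    have hJid : Jstar.map (RingHom.id F) = Jstar := by
      ext i k
      rfl
    intro i k hik
    rw [hJid]
    change (((b : Matrix (Fin 2) (Fin 2) F).map (cmConjRingHom F))ᵀ * Jstar * (b : Matrix (Fin 2) (Fin 2) F)) i k = 0
    rw [hgram]
    fin_cases i <;> fin_cases k
    · exact absurd rfl hik
    · change hermForm (cmConjRingHom F) Jstar (fun l => (b : Matrix (Fin 2) (Fin 2) F) l 0) (fun l => (b : Matrix (Fin 2) (Fin 2) F) l 1) = 0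
      rw [hb1]; exact hperp
    · change hermForm (cmConjRingHom F) Jstar (fun l => (b : Matrix (Fin 2) (Fin 2) F) l 1) (fun l => (b : Matrix (Fin 2) (Fin 2) F) l 0) = 0
      rw [hb1]; exact hperp'
    · exact absurd rfl hik
  -- the line condition: the only `ρ` over `ι₁` is `ι₁`, and `b_1 = w`
  have hline : ∀ ρ : Φ.1, ρ.1.comp (RingHom.id F) = ι₁ → ∃ c : ℂ, c ≠ 0 ∧
      (fun i => ι₁ (w i)) = c • fun i => ρ.1 ((b : Matrix (Fin 2) (Fin 2) F) i 1) := by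
    intro ρ hρ
    rw [RingHom.comp_id] at hρ
    refine ⟨1, one_ne_zero, ?_⟩
    rw [one_smul, hρ, ← hb1]
  refine isSpecial_auxComplexStructureV_of_frame Fr ι₁ Φ hι₁ _ hv b 1 hB hline c hc (hJC _ hw) Φ' (fun p hp => ?_) (fun ρ => ?_)
  · have hp0 : p = 0 := by
      fin_cases p
      · rfl
      · exact absurd rfl hp
    rw [hp0, h0]
  · simp only [RingHom.comp_id]
    exact h1 ρ

end Special

end AuxV

end UnitaryCurve

end Literature.AlgebraicGeometry.ShimuraVarieties

end
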